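import Literature.IUT.HodgeArakelov.CohomologyLimitCyclotomeInvariants
import Literature.IUT.HodgeArakelov.EtaleThetaDataOfSetting
import Literature.AnabelianGeometry.AbsoluteAnabelian.GaloisPadicLogInstance

/-!
# The [IUTchII] §1 model `Π = Π^tp_X̲̲`: the Galois action of `Π` on `ℚ̄_pˣ` through `ε`, and the Kummer map of
# the constants INTO the genuine cohomology limits `lim_K H¹(Π_Ÿ ⊓ K, l·Δ_Θ)` / `lim_K H¹(K, l·Δ_Θ)` (instantiation)

abc-iut cell, D-0067 wave 4 (seat abc-iut-w4-d007 gen 2; layer L6; GAP-LEDGER G-w4d019-1 — its θ-side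
INSTANTIATION; SUBDAG-IUTchII-Cor-112 rows Cor-112.0.r1 / r3 / r7).  S. Mochizuki, *Inter-universal Teichmüller
theory II*, Prop. 3.1 (ii) p. 88 ("`Ψ_cns(M^Θ_*) := M_TM(M^Θ_*) ⊆ lim_J H¹(Π_Ÿ(M^Θ_*)|_J, Π_μ(M^Θ_*))` … naturally
isomorphic to `O^▷_{F̄_v}` … equipped with a natural conjugation action"), Cor. 1.12 (c) p. 56 ("a natural
inclusion `M^×_TM(Π) ↪ lim_J H¹(J, (l·Δ_Θ)(Π))`, hence … into `lim_J H¹(Π_Ÿ(Π)|_J, (l·Δ_Θ)(Π))`")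
[cite: Mochizuki2012, Cor 1.12 p.56]; the model is abc-iut-L6-t1's `EtaleThetaDataOfSetting` (p411758) over the
[EtTh] §1–§2 data of abc-iut-L2 (`D : ThetaSetting p`, `E : D.EtaleThetaData`, `C : E.DoubleUnderline l`;
`Π := Pi C = Π^tp_X̲̲`, `Π_Ÿ(Π) := PiYdd C = Π^tp_Ÿ̲̲`, cohomology `coh C = cohomologySystemOfContH1 (phi C) (l·Δ_Θ) (PiYdd C)`).

WHAT THIS FILE SUPPLIES (the inputs every Kummer-theoretic model statement over `Pi C` needs; everything else is
in the generic files `CohomologyLimitKummer(Galois|MLF|Restrict|…)` / `CohomologyLimitCyclotomeInvariants`):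
* `padicMLF p` — abc-iut-L4's `ℚ_p`-model `MLFClosure.padic p` (`k := ℚ_p`, `k̄ := ℚ̄_p = PadicAlgCl p`) re-packaged
  REDUCIBLY (`abbrev`; `padicMLF_eq : padicMLF p = MLFClosure.padic p` by `rfl`) — needed so that instances stated on
  `(PadicAlgCl p)ˣ` are found for `((padicMLF p).K)ˣ` by typeclass resolution;
* `EtaleThetaDataOfSetting.aug C : Pi C →* G_{ℚ_p}` — `ε` restricted to `Π^tp_X̲̲` ([SemiAnbd] §6 / [EtTh] §1:
  `Π^tp_X → G_K ≤ G_{ℚ_p}`), continuous, with image `G_K` (`range_aug`, from abc-iut-L2-t8's `map_aug_Huu`) of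
  finite index `[K : ℚ_p]` in `G_{ℚ_p}` (`finiteIndex_GK`), and `ε(Π^tp_Ÿ̲̲) = G_K` (abc-iut-L2-t8's
  `map_aug_Ydduu`, [EtTh] Prop. 2.2 (iii); = abc-iut-w4-d041's `map_aug_PiYdd`) of finite index too;
* **`EtaleThetaDataOfSetting.unitsAction C : MulDistribMulAction (Pi C) (PadicAlgCl p)ˣ`** — THE Galois action
  of `Π^tp_X̲̲` on `ℚ̄_pˣ` through `ε` (an instance; `units_coe_smul : (g • u : ℚ̄_p) = ε(g) u` by `rfl`).  TODO-merge:
  if abc-iut-L2/L3 land the `Π^tp_X`-action on `ℚ̄_p`, replace by the inherited instance;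
* hence, for ANY coefficients `A' ⊴ G'` along `φ : Pi C → G'` (the model: `phi C`, `l·Δ_Θ`) and any BIJECTIVE
  change of coefficient cyclotome `c : Λ(ℚ̄_pˣ) = Ẑ(1) ⥲ A'` (the "`Δ_Θ ≅ Ẑ(1)`" / Cor. 1.11 (a) datum — NOT
  constructed here; abc-iut-L2's root interface defers it, FACT-LIST F-0658 `DeltaThetaIsoTate`; cf. abc-iut-w4-
  d041's Tate-twist binders in `EtaleThetaDataOfSettingTateTwist.lean`): the stabiliser inputs
  (`isOpen_stabilizer_units`, `finiteIndex_stabilizer_units`), **`h1LimKummer_injective_of_coeff`** (the Kummer map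
  `ℚ̄_pˣ → lim_K H¹(H ⊓ K, A')` is INJECTIVE for every `H ≤ Pi C` with `ε(H)` of finite index — `H = Π^tp_Ÿ̲̲`:
  Prop. 3.1 (ii)'s "`⊆`"; `H = ⊤`: Cor. 1.12 (c)'s first inclusion), and **`h1LimRestrict_PiYdd_injective_of_coeff`**
  (Cor. 1.12 (c)'s second inclusion `lim_J H¹(J,·) ↪ lim_J H¹(Π_Ÿ|_J,·)` — abc-iut-L6-t1's interface field
  `ThetaEvaluation.inclHd_injective` — at the model, from `CohomologyLimitCyclotomeInvariants`).
Claim key `Mochizuki2012` (D-0012, DISPUTED) for the interface; [EtTh]/[SemiAnbd] refereed; the construction is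
Mathlib Galois theory.  No Prop fact; nothing here bears on [IUTchIII] Cor. 3.12; typed/instantiated ≠ proved.
-/

noncomputable section

namespace Literature.IUT.HodgeArakelov

open Literature.AnabelianGeometry.EtaleTheta Literature.AnabelianGeometry.AbsoluteAnabelian
open Literature.AnabelianGeometry.SemiGraphs CohomologySystemOfContH1

/-- abc-iut-L4's `ℚ_p`-MODEL of `MLFClosure` ([AbsTopIII] Def. 3.1 (i): "`k` an MLF, `k̄` an algebraic closure"),
`k := ℚ_p`, `k̄ := ℚ̄_p = PadicAlgCl p`, packaged REDUCIBLY (see `padicMLF_eq`: it IS `MLFClosure.padic p`) so that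
`(padicMLF p).K` unfolds to `PadicAlgCl p` during typeclass resolution. [cite: MochizukiAbsTopIII2015, Definition 3.1 (i) p.66] -/
abbrev padicMLF (p : ℕ) [Fact p.Prime] : MLFClosure.{0} :=
  { k := ℚ_[p]
    instLocal := Literature.NumberTheory.GaloisRepresentations.Padic.isNonarchimedeanLocalField_holds p
    K := PadicAlgCl p }

/-- `padicMLF p` is (definitionally) abc-iut-L4's `MLFClosure.padic p`. [cite: MochizukiAbsTopIII2015, Definition 3.1 (i) p.66] -/
theorem padicMLF_eq (p : ℕ) [Fact p.Prime] : padicMLF p = MLFClosure.padic p := rfl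

namespace EtaleThetaDataOfSetting

variable {p : ℕ} [Fact p.Prime] {D : Literature.AnabelianGeometry.EtaleTheta.ThetaSetting p}
  {E : D.EtaleThetaData} {l : ℕ} (C : E.DoubleUnderline l)

/-! ### `ε` on `Π^tp_X̲̲`, its image, and the Galois action on `ℚ̄_pˣ` -/

/-- `ε : Π^tp_X̲̲ → G_{ℚ_p}`, the augmentation of [SemiAnbd] §6 restricted to `Π^tp_X̲̲ ⊆ Π^tp_X`.
[cite: MochizukiSemiAnbd2006, §6 p.69] -/
abbrev aug : (Pi C) →* GQp p := D.aug.toMonoidHom.comp C.Huu.subtype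

/-- `ε` on `Π^tp_X̲̲` is continuous. [cite: MochizukiSemiAnbd2006, §6 p.69] -/
theorem continuous_aug : Continuous (aug C) :=
  D.aug.continuous_toFun.comp continuous_subtype_val

/-- `ε(Π^tp_X̲̲) = G_K` ([EtTh] Prop. 2.2 (iii) "`G_K ≅ Π_X̲̲/Δ_X̲̲`"; abc-iut-L2-t8's `map_aug_Huu`).
[cite: MochizukiEtTh2009, Prop 2.2 (iii) p.37] -/
theorem range_aug : (aug C).range = D.GK := by
  rw [aug, MonoidHom.range_comp, Subgroup.range_subtype]
  exact C.map_aug_Huu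

/-- `G_K = Gal(ℚ̄_p/K)` has FINITE INDEX `[K : ℚ_p]` in `G_{ℚ_p}`. [cite: MochizukiSemiAnbd2006, §6 p.69] -/
theorem finiteIndex_GK (D₀ : Literature.AnabelianGeometry.EtaleTheta.ThetaSetting p) : D₀.GK.FiniteIndex := by
  have h := TemperedCurve.finiteIndex_range_aug D₀.toTemperedCurve
  rw [D₀.range_aug] at h
  exact h

/-- `ℚ̄_pˣ` is divisible (roots of all orders: `ℚ̄_p` is algebraically closed) — abc-iut-L4's instance
`MLFClosure.rootableByUnits` read on the reducible model `padicMLF p` (same term, so that the generic Kummer files,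
which use that instance, apply verbatim). [cite: MochizukiAbsTopIII2015, Definition 3.1 (i) p.66] -/
instance rootableByUnits : RootableBy (PadicAlgCl p)ˣ ℕ := MLFClosure.rootableByUnits (padicMLF p)

/-- `ε(Π^tp_X̲̲)` has finite index in `G_{ℚ_p}`. [cite: MochizukiSemiAnbd2006, §6 p.69] -/
instance finiteIndex_range_aug : (aug C).range.FiniteIndex := by
  rw [range_aug]; exact finiteIndex_GK D

/-- `ε(Π^tp_Ÿ̲̲) = G_K` (abc-iut-L2-t8's `map_aug_Ydduu` read on `Π^tp_X̲̲`; the same equation is abc-iut-w4-d041's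
`map_aug_PiYdd`, not yet built on the farm at filing time — reproved inline, no second name) has finite index in
`G_{ℚ_p}`. [cite: MochizukiEtTh2009, Prop 2.2 (iii) p.37] -/
instance finiteIndex_map_aug_PiYdd : (Subgroup.map (aug C) (PiYdd C)).FiniteIndex := by
  have h : Subgroup.map (aug C) (PiYdd C) = D.GK := by
    rw [aug, ← Subgroup.map_map, Subgroup.subgroupOf_map_subtype, inf_eq_left.mpr inf_le_right]
    exact C.map_aug_Ydduu
  rw [h]
  exact finiteIndex_GK D

/-- `ε(Π^tp_X̲̲) = ε(⊤)` has finite index (instance form for `H = ⊤`). [cite: MochizukiSemiAnbd2006, §6 p.69] -/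
instance finiteIndex_map_aug_top : (Subgroup.map (aug C) (⊤ : Subgroup (Pi C))).FiniteIndex := by
  rw [← MonoidHom.range_eq_map]; infer_instance

/-- **The Galois action of `Π^tp_X̲̲` on `ℚ̄_pˣ` through `ε`** (`g • u := ε(g)(u)`): the `Π`-module structure on
the constants `k̄ˣ ⊇ 𝒪_k̄^▷ = O^▷_{F̄_v}` of [IUTchII] Ex. 1.8 (ii) / Prop. 3.1 (ii) at the model.  TODO-merge: the
inherited instance once abc-iut-L2/L3 land the `Π^tp_X`-action on `ℚ̄_p`. [cite: Mochizuki2012, Prop 3.1 (ii) p.88] -/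
instance unitsAction : MulDistribMulAction (Pi C) (PadicAlgCl p)ˣ where
  smul g u := Units.map (MulDistribMulAction.toMonoidHom (PadicAlgCl p) (aug C g)) u
  one_smul u := Units.ext (by
    change aug C 1 • (u : PadicAlgCl p) = u
    rw [map_one, one_smul])
  mul_smul g h u := Units.ext (by
    change aug C (g * h) • (u : PadicAlgCl p) = aug C g • (aug C h • (u : PadicAlgCl p))
    rw [map_mul, mul_smul])
  smul_mul g u v := Units.ext (smul_mul' (aug C g) (u : PadicAlgCl p) (v : PadicAlgCl p))
  smul_one g := Units.ext (smul_one (aug C g))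

/-- The action on underlying elements: `(g • u : ℚ̄_p) = ε(g)(u)` — the hypothesis `haug` of
`CohomologyLimitKummerGalois.lean`, by `rfl`. [cite: Mochizuki2012, Prop 3.1 (ii) p.88] -/
@[simp] theorem units_coe_smul (g : Pi C) (u : (PadicAlgCl p)ˣ) :
    ((g • u : (PadicAlgCl p)ˣ) : PadicAlgCl p) = aug C g (u : PadicAlgCl p) := rfl

/-- The same, read through the reducible model `padicMLF p` (the shape `haug` literally).
[cite: Mochizuki2012, Prop 3.1 (ii) p.88] -/
theorem units_coe_smul' (g : Pi C) (u : ((padicMLF p).K)ˣ) :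
    ((g • u : ((padicMLF p).K)ˣ) : (padicMLF p).K) = aug C g (u : (padicMLF p).K) := rfl

/-! ### The inputs of the Kummer map at the model -/

/-- **`hA` at the model**: stabilisers in `Π^tp_X̲̲` of units of `ℚ̄_p` are open. [cite: Mochizuki2012, Prop 3.1 (ii) p.88] -/
theorem isOpen_stabilizer_units (u : (PadicAlgCl p)ˣ) : IsOpen (MulAction.stabilizer (Pi C) u : Set (Pi C)) :=
  isOpen_stabilizer_units_of_aug (padicMLF p) (aug C) (units_coe_smul' C) (continuous_aug C) u

/-- **`hfi` at the model**: stabilisers in `Π^tp_X̲̲` of units of `ℚ̄_p` have finite index.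
[cite: Mochizuki2012, Prop 3.1 (ii) p.88] -/
theorem finiteIndex_stabilizer_units (u : (PadicAlgCl p)ˣ) : (MulAction.stabilizer (Pi C) u).FiniteIndex :=
  finiteIndex_stabilizer_units_of_aug (padicMLF p) (aug C) (units_coe_smul' C) u

/-- **`hroots` at the model**: a unit of `ℚ̄_p` with a compatible system of roots all fixed by `H ⊓ K` —
`H ≤ Π^tp_X̲̲` with `ε(H)` of finite index (e.g. `Π^tp_Ÿ̲̲`, `⊤`), `K` of finite index — is `1`.
[cite: MochizukiAbsTopIII2015, Rmk 1.5.4 (i) p.33] -/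
theorem units_eq_one_of_isInvariant (H K : Subgroup (Pi C)) [(Subgroup.map (aug C) H).FiniteIndex]
    [K.FiniteIndex] (u : (PadicAlgCl p)ˣ) (y : RootSystem u) (hy : y.IsInvariant (H ⊓ K)) : u = 1 :=
  units_eq_one_of_isInvariant_of_aug (padicMLF p) (aug C) (units_coe_smul' C) H K u y hy

section Coefficients

variable {G' : Type} [Group G'] [TopologicalSpace G'] [IsTopologicalGroup G']
  (φ : (Pi C) →* G') (A' : Subgroup G') [A'.Normal] [IsMulCommutative A']
  [TopologicalSpace (PadicAlgCl p)ˣ] (c : CyclotomeCoefficients φ A' (PadicAlgCl p)ˣ)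

/-- **Injectivity of the Kummer map at the model** ("`Ψ_cns := M_TM ⊆ lim_J H¹(Π_Ÿ|_J, Π_μ)`" for `H = Π^tp_Ÿ̲̲`;
"`M^×_TM(Π) ↪ lim_J H¹(J, (l·Δ_Θ)(Π))`" for `H = ⊤`): for every `H ≤ Π^tp_X̲̲` with `ε(H)` of finite index, every
coefficient group `A'` along `φ : Π^tp_X̲̲ → G'` (the model: `phi C`, `l·Δ_Θ`) and every BIJECTIVE change of
coefficient cyclotome `c : Ẑ(1) ⥲ A'` (the "`Δ_Θ ≅ Ẑ(1)`" / Cor. 1.11 (a) DATUM), `h1LimKummer` is injective.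
[cite: Mochizuki2012, Cor 1.12 p.56] -/
theorem h1LimKummer_injective_of_coeff (H : Subgroup (Pi C)) [(Subgroup.map (aug C) H).FiniteIndex]
    (hc : Function.Bijective c.hom) :
    Function.Injective
      (h1LimKummer φ A' H c (isOpen_stabilizer_units C) (finiteIndex_stabilizer_units C)) :=
  h1LimKummer_injective_of_aug (padicMLF p) (aug C) (units_coe_smul' C) φ A' H c (continuous_aug C) hc

/-- **Cor. 1.12 (c)'s second inclusion at the model**: the restriction
`lim_K H¹(K, A') → lim_K H¹(Π^tp_Ÿ̲̲ ⊓ K, A')` of abc-iut-L6-t1's cohomology limits (`h1LimRestrict`) is INJECTIVE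
for coefficients `A' ≅ Ẑ(1)` (bijective `c`) — abc-iut-L6-t1's interface field `ThetaEvaluation.inclHd_injective`,
from `CohomologyLimitCyclotomeInvariants` (`Π^tp_Ÿ̲̲` normal: abc-iut-L6-t1's `piYdd_normal`).
[cite: Mochizuki2012, Cor 1.12 p.56] -/
theorem h1LimRestrict_PiYdd_injective_of_coeff (hC : D.Compat) (hc : Function.Bijective c.hom) :
    Function.Injective (h1LimRestrict φ A' (le_top : PiYdd C ≤ ⊤) ⊥) :=
  haveI := piYdd_normal C hC
  h1LimRestrict_top_bot_injective_of_aug (padicMLF p) (aug C) (units_coe_smul' C) φ A' c hc (PiYdd C)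

/-- **`Π`-stability of the Kummer image of the constants** at the model: the Kummer image in
`lim_K H¹(Π^tp_Ÿ̲̲ ⊓ K, A')` of any Galois-stable submonoid of `ℚ̄_pˣ` (the constants `𝒪^▷`, the units `𝒪^×`,
all of `ℚ̄_pˣ`) is stable under the conjugation action `h1LimConjMulAut` — "equipped with a natural conjugation
action by `Π_X(M^Θ_*)`". [cite: Mochizuki2012, Prop 3.1 (ii) p.88] -/
theorem map_h1LimKummer_PiYdd_stable (hC : D.Compat) (O : Submonoid (PadicAlgCl p)ˣ)
    (hO : ∀ (σ : GQp p) (u : (PadicAlgCl p)ˣ), u ∈ O → Units.map (σ : PadicAlgCl p →* PadicAlgCl p) u ∈ O)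
    (g : Pi C) (y : Multiplicative (h1Lim φ A' (PiYdd C) ⊥))
    (hy : y ∈ O.map (h1LimKummer φ A' (PiYdd C) c (isOpen_stabilizer_units C)
      (finiteIndex_stabilizer_units C))) :
    haveI := piYdd_normal C hC
    h1LimConjMulAut φ A' (PiYdd C) g y ∈ O.map (h1LimKummer φ A' (PiYdd C) c (isOpen_stabilizer_units C)
      (finiteIndex_stabilizer_units C)) :=
  haveI := piYdd_normal C hC
  map_h1LimKummer_stable_of_aug (padicMLF p) (aug C) (units_coe_smul' C) φ A' (PiYdd C) c (continuous_aug C)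
    O hO g y hy

end Coefficients

end EtaleThetaDataOfSetting

end Literature.IUT.HodgeArakelov

end
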